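import Mathlib.Analysis.SpecialFunctions.SmoothTransition
import Mathlib.Analysis.InnerProductSpace.Calculus
import Mathlib.Analysis.Calculus.Deriv.Inv
import Mathlib.Analysis.Calculus.Deriv.Comp
import Mathlib.Analysis.Calculus.ContDiff.Deriv
import Mathlib.Analysis.Calculus.Deriv.MeanValue
import Mathlib.Analysis.Normed.Operator.BoundedLinearMaps
import Mathlib.MeasureTheory.Integral.IntervalIntegral.FundThmCalculus
import Mathlib.Geometry.Manifold.MFDeriv.FDeriv
import Mathlib.Geometry.Manifold.MFDeriv.SpecificFunctions
import Mathlib.Geometry.Manifold.ContMDiffMFDeriv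
import Literature.Topology.FourManifolds.SliceRibbon
import Literature.Topology.FourManifolds.InverseFunctionTheorem
import HarnessLib

/-!
# Straightening a concordance near its inner end (fact B of `SliceGenusConcordance`)

Trunk T-4MAN (`Literature/Topology/FourManifolds`).  This file **proves** the straightening
statement vendored as the named fact `Literature.Topology.FourManifolds.Knot.IsConcordant.exists_radial` in
`SliceGenusConcordance.lean` (decomposition of the concordance invariance of the slice genus,
`Literature.Topology.FourManifolds.Knot.IsConcordant.sliceGenus_eq`, Livingston 2005, §9.5):

* `Literature.Topology.FourManifolds.Knot.Straightening.exists_isConcordance_radial`: **every concordance `f` from `K` to `K'`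
  (`Literature.Topology.FourManifolds.Knot.IsConcordance`: a neat annulus `𝕊 1 × ℝ → ℝ⁴` in the shell `1 ≤ ‖y‖ ≤ 2` from `K`
  to `2 • K'`) can be replaced by a concordance from `K` to `K'` which is the cone
  `(x, t) ↦ t • K x` for `t ∈ [1, 1 + δ]`, some `δ > 0`.**

This is the classical normalisation "a neat submanifold is vertical in a suitable collar of the
boundary" (Kosinski 1993, II (2.8.2); Hirsch 1976, Ch. 4 §6, Thm. 6.2) for the radial collar of
`𝕊 3` in the shell, carried out by explicit formulas:

1. **Uniform estimates** (`exists_radialDeriv_pos`, `exists_norm_sub_one_lt`): neatness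
   (`∂ₜ ‖f (x, t)‖² > 0` at `t = 1`) persists on a uniform strip `|t - 1| < λ₀`, by continuity of
   the derivative along the lift `(θ, t) ↦ f (circlePoint θ, t)` to `ℝ²`, compactness of `𝕊 1`
   and the tube lemma; likewise `‖f‖` is uniformly close to `1` near the seam.
2. **Re-timing** (`RetimeData`, `retime`): with the smooth clamp `c` (primitive of a plateau bump,
   `clamp`) and a fixed smooth step `ψ`, the function
   `R (x, t) = t + (1 - ψ t) (‖f (x, c t)‖ - c t)` equals `‖f (x, t)‖` for `|t - 1| ≤ l`, equals
   `t` for `t ≥ 3/2`, satisfies `R (x, 1) = 1`, `R (x, 2) = 2`, and `∂ₜ R > 0` everywhere (on the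
   strip a convex combination of `1` and `∂ₜ‖f‖ > 0`; off it `1 - ψ' · O(l) ≥ 1/2` by the choice
   of `l`), hence each `R (x, ·)` is a bijection of `ℝ`.
3. **The shear** `Φ (x, t) = (x, R (x, t))` is smooth and bijective with differential the shear
   `ContinuousLinearEquiv.skewProd`; by the inverse function theorem on manifolds
   (`Literature.Topology.FourManifolds.diffeomorphOfBijectiveOfMfderiv`, `InverseFunctionTheorem.lean`) it is a diffeomorphism
   of `𝕊 1 × ℝ` (`RetimeData.shearDiffeo`), and `f ∘ Φ⁻¹` is a concordance from `K` to `K'` which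
   is *level preserving*, `‖f₁ (x, ρ)‖ = ρ`, on a uniform zone `[1, 1 + η]`
   (`exists_isConcordance_norm_eq`).
4. **Freezing** (`freeze`): `f₂ (x, ρ) = (ρ / c₂ ρ) • f₁ (x, c₂ ρ)` with
   `c₂ ρ = 1 + (ρ - 1) S((ρ - 1 - δ)/δ)` is the cone for `ρ ≤ 1 + δ`, equals `f₁` for
   `ρ ≥ 1 + 2δ`, and is still a concordance: injective by separating norms (`‖f₂‖ = ρ` on the
   frozen zone, the far part of the annulus staying outside radius `m > 1` by compactness), and an
   immersion because `‖f₂ (x, ρ)‖ = ρ` forces `⟪f₂, Df₂ w⟫ = ρ w₂` (`inner_mfderiv_of_norm_eq_snd`)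
   while horizontally `Df₂ ∘ inl = (ρ / c₂ ρ) • Df₁ ∘ inl` (restriction to the circle).

No new definitions of mathematical notions are introduced; the `def`s of this file (`plateau`,
`clamp`, `step`, `clampAt`, `retime`, `RetimeData`, `shear`, `freezeTime`, `freeze`, …) are the
auxiliary constructions of the proof.

## References

* A. A. Kosinski, *Differential Manifolds* (1993), I §7 (collars), II (2.8.2) (a neat
  submanifold meets a suitable collar of the boundary in a collar). [Kosinski1993]
* M. W. Hirsch, *Differential Topology* (1976), Ch. 4 §6, Thms. 6.1–6.2. [HirschDT1976]
* C. Livingston, *A survey of classical knot concordance* (2005), §9.5. [Livingston2005]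
* Tree: `Literature.Topology.FourManifolds.Knot.IsConcordance` (`SliceRibbon.lean`), `Literature.Topology.FourManifolds.circlePoint` (`Knots.lean`),
  `Literature.Topology.FourManifolds.diffeomorphOfBijectiveOfMfderiv` (`InverseFunctionTheorem.lean`).
* Mathlib: `Real.smoothTransition`, `intervalIntegral.integral_hasDerivAt_right`,
  `generalized_tube_lemma`, `ContinuousLinearEquiv.skewProd`, `mfderiv_prodMk`,
  `mfderiv_prod_left`, `mfderiv_prod_right`, `hasStrictFDerivAt_norm_sq`.
-/

open scoped Manifold ContDiff Topology
open Function Set MeasureTheory intervalIntegral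

noncomputable section

namespace Literature.Topology.FourManifolds

/-- Local notation: `𝔼 n` is the model Euclidean space `EuclideanSpace ℝ (Fin n)`. -/
local notation "𝔼 " n:arg => EuclideanSpace ℝ (Fin n)

/-- Local notation: `𝕊 n` is the unit sphere in `EuclideanSpace ℝ (Fin (n + 1))`. -/
local notation "𝕊 " n:arg => (Metric.sphere (0 : EuclideanSpace ℝ (Fin (n + 1))) 1)

namespace Knot

namespace Straightening

/-! ### One-variable tools: a plateau bump and its primitive (a smooth clamp) -/

/-- The **plateau bump** `b(u) = S(u + 2) S(2 - u)` (`S = Real.smoothTransition`): smooth, with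
values in `[0, 1]`, equal to `1` on `[-1, 1]` and to `0` off `(-2, 2)`. [folklore] -/
def plateau (u : ℝ) : ℝ :=
  Real.smoothTransition (u + 2) * Real.smoothTransition (2 - u)

/-- `0 ≤ b`. [folklore] -/
theorem plateau_nonneg (u : ℝ) : 0 ≤ plateau u :=
  mul_nonneg (Real.smoothTransition.nonneg _) (Real.smoothTransition.nonneg _)

/-- `b ≤ 1`. [folklore] -/
theorem plateau_le_one (u : ℝ) : plateau u ≤ 1 :=
  mul_le_one₀ (Real.smoothTransition.le_one _) (Real.smoothTransition.nonneg _)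
    (Real.smoothTransition.le_one _)

/-- `b = 1` on `[-1, 1]`. [folklore] -/
theorem plateau_of_abs_le {u : ℝ} (hu : |u| ≤ 1) : plateau u = 1 := by
  rw [abs_le] at hu
  unfold plateau
  rw [Real.smoothTransition.one_of_one_le (by linarith),
    Real.smoothTransition.one_of_one_le (by linarith), one_mul]

/-- `b = 0` on `(-∞, -2]`. [folklore] -/
theorem plateau_of_le {u : ℝ} (hu : u ≤ -2) : plateau u = 0 := by
  unfold plateau
  rw [Real.smoothTransition.zero_of_nonpos (by linarith), zero_mul]

/-- `b = 0` on `[2, ∞)`. [folklore] -/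
theorem plateau_of_ge {u : ℝ} (hu : 2 ≤ u) : plateau u = 0 := by
  unfold plateau
  rw [Real.smoothTransition.zero_of_nonpos (sub_nonpos.2 hu), mul_zero]

/-- `b` is `C^∞`. [folklore] -/
theorem contDiff_plateau : ContDiff ℝ ∞ plateau :=
  (Real.smoothTransition.contDiff.comp (contDiff_id.add contDiff_const)).mul
    (Real.smoothTransition.contDiff.comp (contDiff_const.sub contDiff_id))

/-- `b` is continuous. [folklore] -/
theorem continuous_plateau : Continuous plateau :=
  contDiff_plateau.continuous

/-- The **smooth clamp** `κ(u) = ∫₀ᵘ b`: smooth, `κ' = b ∈ [0, 1]`, `κ u = u` on `[-1, 1]`,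
`|κ| ≤ 2`. [folklore] -/
def clamp (u : ℝ) : ℝ :=
  ∫ s in (0 : ℝ)..u, plateau s

/-- `κ' = b`. [folklore] -/
theorem hasDerivAt_clamp (u : ℝ) : HasDerivAt clamp (plateau u) u :=
  integral_hasDerivAt_right (continuous_plateau.intervalIntegrable _ _)
    (continuous_plateau.stronglyMeasurableAtFilter _ _) continuous_plateau.continuousAt

/-- `deriv κ = b`. [folklore] -/
theorem deriv_clamp : deriv clamp = plateau :=
  funext fun u ↦ (hasDerivAt_clamp u).deriv

/-- `κ` is `C^∞`. [folklore] -/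
theorem contDiff_clamp : ContDiff ℝ ∞ clamp := by
  rw [contDiff_infty_iff_deriv, deriv_clamp]
  exact ⟨fun u ↦ (hasDerivAt_clamp u).differentiableAt, contDiff_plateau⟩

/-- `κ` is monotone. [folklore] -/
theorem monotone_clamp : Monotone clamp :=
  monotone_of_deriv_nonneg (fun u ↦ (hasDerivAt_clamp u).differentiableAt)
    fun u ↦ by rw [deriv_clamp]; exact plateau_nonneg u

/-- `κ u = u` on `[-1, 1]`. [folklore] -/
theorem clamp_of_abs_le {u : ℝ} (hu : |u| ≤ 1) : clamp u = u := by
  unfold clamp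
  have h : EqOn plateau (fun _ ↦ (1 : ℝ)) (uIcc 0 u) := by
    intro s hs
    refine plateau_of_abs_le ?_
    rw [abs_le] at hu ⊢
    rcases le_total 0 u with h0 | h0
    · rw [uIcc_of_le h0] at hs
      exact ⟨by linarith [hs.1], by linarith [hs.2]⟩
    · rw [uIcc_of_ge h0] at hs
      exact ⟨by linarith [hs.1], by linarith [hs.2]⟩
  rw [integral_congr h, intervalIntegral.integral_const, smul_eq_mul, mul_one, sub_zero]

/-- `κ` is constant on `[2, ∞)`. [folklore] -/
theorem clamp_of_two_le {u : ℝ} (hu : 2 ≤ u) : clamp u = clamp 2 := by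
  unfold clamp
  rw [← integral_add_adjacent_intervals (continuous_plateau.intervalIntegrable 0 2)
    (continuous_plateau.intervalIntegrable 2 u)]
  have h : EqOn plateau (fun _ ↦ (0 : ℝ)) (uIcc 2 u) := by
    intro s hs
    rw [uIcc_of_le hu] at hs
    exact plateau_of_ge hs.1
  rw [integral_congr h, intervalIntegral.integral_const, smul_zero, add_zero]

/-- `κ` is constant on `(-∞, -2]`. [folklore] -/
theorem clamp_of_le_neg_two {u : ℝ} (hu : u ≤ -2) : clamp u = clamp (-2) := by
  unfold clamp
  rw [← integral_add_adjacent_intervals (continuous_plateau.intervalIntegrable 0 (-2))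
    (continuous_plateau.intervalIntegrable (-2) u)]
  have h : EqOn plateau (fun _ ↦ (0 : ℝ)) (uIcc (-2) u) := by
    intro s hs
    rw [uIcc_of_ge hu] at hs
    exact plateau_of_le hs.2
  rw [integral_congr h, intervalIntegral.integral_const, smul_zero, add_zero]

/-- `|κ u| ≤ |u|`. [folklore] -/
theorem abs_clamp_le (u : ℝ) : |clamp u| ≤ |u| := by
  unfold clamp
  have := norm_integral_le_of_norm_le_const (a := (0 : ℝ)) (b := u) (C := 1) (f := plateau)
    fun s _ ↦ by
      rw [Real.norm_of_nonneg (plateau_nonneg s)]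
      exact plateau_le_one s
  simpa using this

/-- `|κ| ≤ 2`. [folklore] -/
theorem abs_clamp_le_two (u : ℝ) : |clamp u| ≤ 2 := by
  rcases le_total u 2 with h2 | h2
  · rcases le_total (-2) u with h1 | h1
    · exact (abs_clamp_le u).trans (abs_le.2 ⟨by linarith, h2⟩)
    · rw [clamp_of_le_neg_two h1]
      simpa using abs_clamp_le (-2)
  · rw [clamp_of_two_le h2]
    simpa using abs_clamp_le 2

/-! ### The fixed smooth step `ψ` and a bound on its derivative -/

/-- The **smooth step** `ψ(t) = S(4 (t - 5/4))`: `0` for `t ≤ 5/4`, `1` for `t ≥ 3/2`, values in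
`[0, 1]`. [folklore] -/
def step (t : ℝ) : ℝ :=
  Real.smoothTransition (4 * (t - 5 / 4))

/-- `ψ` is `C^∞`. [folklore] -/
theorem contDiff_step : ContDiff ℝ ∞ step :=
  Real.smoothTransition.contDiff.comp (contDiff_const.mul (contDiff_id.sub contDiff_const))

/-- `ψ = 0` on `(-∞, 5/4]`. [folklore] -/
theorem step_of_le {t : ℝ} (ht : t ≤ 5 / 4) : step t = 0 :=
  Real.smoothTransition.zero_of_nonpos (by linarith)

/-- `ψ = 1` on `[3/2, ∞)`. [folklore] -/
theorem step_of_ge {t : ℝ} (ht : 3 / 2 ≤ t) : step t = 1 :=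
  Real.smoothTransition.one_of_one_le (by linarith)

/-- `0 ≤ ψ`. [folklore] -/
theorem step_nonneg (t : ℝ) : 0 ≤ step t :=
  Real.smoothTransition.nonneg _

/-- `ψ ≤ 1`. [folklore] -/
theorem step_le_one (t : ℝ) : step t ≤ 1 :=
  Real.smoothTransition.le_one _

/-- `ψ` is differentiable. [folklore] -/
theorem hasDerivAt_step (t : ℝ) : HasDerivAt step (deriv step t) t :=
  ((contDiff_step.differentiable (by simp)) t).hasDerivAt

/-- `ψ' = 0` off `[5/4, 3/2]`… more precisely on `(-∞, 5/4)`. [folklore] -/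
theorem deriv_step_of_lt {t : ℝ} (ht : t < 5 / 4) : deriv step t = 0 := by
  have : step =ᶠ[𝓝 t] fun _ ↦ 0 := by
    filter_upwards [Iio_mem_nhds ht] with s hs using step_of_le hs.le
  rw [this.deriv_eq, deriv_const]

/-- `ψ' = 0` on `(3/2, ∞)`. [folklore] -/
theorem deriv_step_of_gt {t : ℝ} (ht : 3 / 2 < t) : deriv step t = 0 := by
  have : step =ᶠ[𝓝 t] fun _ ↦ 1 := by
    filter_upwards [Ioi_mem_nhds ht] with s hs using step_of_ge hs.le
  rw [this.deriv_eq, deriv_const]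

/-- **A bound on `|ψ'|`** (continuity of `ψ'` on the compact `[5/4, 3/2]`, `ψ' = 0` elsewhere).
[folklore] -/
theorem exists_bound_deriv_step : ∃ C : ℝ, 0 < C ∧ ∀ t, |deriv step t| ≤ C := by
  have hc : Continuous (deriv step) := contDiff_step.continuous_deriv (by simp)
  obtain ⟨C, hC⟩ := isCompact_Icc.exists_bound_of_continuousOn
    (s := Icc (5 / 4 : ℝ) (3 / 2)) hc.continuousOn
  refine ⟨max C 1, lt_max_of_lt_right one_pos, fun t ↦ ?_⟩
  rcases lt_or_ge t (5 / 4) with h1 | h1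
  · rw [deriv_step_of_lt h1, abs_zero]
    positivity
  rcases lt_or_ge (3 / 2) t with h2 | h2
  · rw [deriv_step_of_gt h2, abs_zero]
    positivity
  exact ((Real.norm_eq_abs _).symm.le.trans (hC t ⟨h1, h2⟩)).trans (le_max_left _ _)


/-! ### Uniform estimates along the seam `𝕊 1 × {1}` -/

/-- `circlePoint : ℝ → 𝕊 1` is `C^∞` into Mathlib's manifold `𝕊 1`. [folklore] -/
theorem contMDiff_circlePoint : ContMDiff 𝓘(ℝ, ℝ) (𝓡 1) ∞ circlePoint := by
  haveI := Fact.mk (@finrank_euclideanSpace_fin ℝ _ (1 + 1))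
  have h := (contDiff_coe_circlePoint.contMDiff).codRestrict_sphere (E := 𝔼 (1 + 1)) (n := 1)
    (fun θ ↦ (circlePoint θ).2)
  have heq : (Set.codRestrict _ _ (fun θ ↦ (circlePoint θ).2) : ℝ → 𝕊 1) = circlePoint :=
    funext fun θ ↦ rfl
  rw [heq] at h
  exact h

/-- Every point of `𝕊 1` is `circlePoint θ` for some `θ ∈ [0, 2π]`. [folklore] -/
theorem exists_circlePoint_eq_mem_Icc (x : 𝕊 1) :
    ∃ θ ∈ Icc (0 : ℝ) (2 * Real.pi), circlePoint θ = x := by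
  obtain ⟨θ₁, rfl⟩ := circlePoint_surjective x
  obtain ⟨θ, hθ, h⟩ := periodic_circlePoint.exists_mem_Ico₀ Real.two_pi_pos θ₁
  exact ⟨θ, Ico_subset_Icc_self hθ, h.symm⟩

variable {f : (𝕊 1) × ℝ → 𝔼 4}

/-- The lift `(θ, s) ↦ f (circlePoint θ, s)` of a `C^∞` map on `𝕊 1 × ℝ` is `C^∞` on `ℝ²`. [folklore] -/
theorem contDiff_lift (hfs : ContMDiff ((𝓡 1).prod 𝓘(ℝ, ℝ)) 𝓘(ℝ, 𝔼 4) ∞ f) :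
    ContDiff ℝ ∞ (fun q : ℝ × ℝ ↦ f (circlePoint q.1, q.2)) := by
  rw [← contMDiff_iff_contDiff]
  have hP : ContMDiff (𝓘(ℝ, ℝ).prod 𝓘(ℝ, ℝ)) ((𝓡 1).prod 𝓘(ℝ, ℝ)) ∞
      (fun q : ℝ × ℝ ↦ (circlePoint q.1, q.2)) :=
    (contMDiff_circlePoint.comp contMDiff_fst).prodMk contMDiff_snd
  have h := hfs.comp hP
  rw [modelWithCornersSelf_prod, ← chartedSpaceSelf_prod]
  exact h

/-- The `s`-derivative of `‖f (x, ·)‖²` at `s`, as a function on `𝕊 1 × ℝ`. [folklore] -/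
def radialDeriv (f : (𝕊 1) × ℝ → 𝔼 4) (p : (𝕊 1) × ℝ) : ℝ :=
  deriv (fun s ↦ ‖f (p.1, s)‖ ^ 2) p.2

/-- Along the lift, `radialDeriv` is the partial derivative `∂_s` of the smooth function
`(θ, s) ↦ ‖f (circlePoint θ, s)‖²` on `ℝ²`. [folklore] -/
theorem radialDeriv_circlePoint (hfs : ContMDiff ((𝓡 1).prod 𝓘(ℝ, ℝ)) 𝓘(ℝ, 𝔼 4) ∞ f)
    (θ s : ℝ) :
    radialDeriv f (circlePoint θ, s) =
      fderiv ℝ (fun q : ℝ × ℝ ↦ ‖f (circlePoint q.1, q.2)‖ ^ 2) (θ, s) (0, 1) := by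
  set G : ℝ × ℝ → ℝ := fun q ↦ ‖f (circlePoint q.1, q.2)‖ ^ 2 with hG
  have hGd : DifferentiableAt ℝ G (θ, s) :=
    (((contDiff_lift hfs).norm_sq ℝ).differentiable (by simp)) _
  have hγ : HasDerivAt (fun s : ℝ ↦ ((θ, s) : ℝ × ℝ)) ((0 : ℝ), (1 : ℝ)) s :=
    (hasDerivAt_const s θ).prodMk (hasDerivAt_id s)
  have h := hGd.hasFDerivAt.comp_hasDerivAt s hγ
  exact h.deriv

/-- `radialDeriv ∘ (circlePoint × id)` is continuous on `ℝ²`. [folklore] -/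
theorem continuous_radialDeriv_lift (hfs : ContMDiff ((𝓡 1).prod 𝓘(ℝ, ℝ)) 𝓘(ℝ, 𝔼 4) ∞ f) :
    Continuous fun q : ℝ × ℝ ↦ radialDeriv f (circlePoint q.1, q.2) := by
  have h : Continuous fun q : ℝ × ℝ ↦
      fderiv ℝ (fun q : ℝ × ℝ ↦ ‖f (circlePoint q.1, q.2)‖ ^ 2) q ((0 : ℝ), (1 : ℝ)) :=
    (((contDiff_lift hfs).norm_sq ℝ).continuous_fderiv (by simp)).clm_apply continuous_const
  convert h using 1
  funext q
  exact radialDeriv_circlePoint hfs q.1 q.2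

/-- **Uniform neatness.** For a concordance, the radial derivative `∂_s ‖f (x, s)‖²`, positive at
`s = 1` by neatness, stays positive on a uniform strip `|s - 1| < l₀` (compactness of `𝕊 1`,
continuity of the derivative along the lift to `ℝ²`, tube lemma). [folklore] -/
theorem exists_radialDeriv_pos (hfs : ContMDiff ((𝓡 1).prod 𝓘(ℝ, ℝ)) 𝓘(ℝ, 𝔼 4) ∞ f)
    (hneat : ∀ x : 𝕊 1, 0 < deriv (fun t ↦ ‖f (x, t)‖ ^ 2) 1) :
    ∃ l₀ : ℝ, 0 < l₀ ∧ ∀ x : 𝕊 1, ∀ s : ℝ, |s - 1| < l₀ → 0 < radialDeriv f (x, s) := by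
  have hDc : Continuous fun q : ℝ × ℝ ↦ radialDeriv f (circlePoint q.1, q.2) :=
    continuous_radialDeriv_lift hfs
  have hW : IsOpen {q : ℝ × ℝ | 0 < radialDeriv f (circlePoint q.1, q.2)} :=
    isOpen_lt continuous_const hDc
  have hsub : Icc (0 : ℝ) (2 * Real.pi) ×ˢ ({1} : Set ℝ) ⊆
      {q : ℝ × ℝ | 0 < radialDeriv f (circlePoint q.1, q.2)} := by
    rintro ⟨θ, s⟩ ⟨-, hs⟩
    rw [mem_singleton_iff] at hs
    subst hs
    simp only [mem_setOf_eq, radialDeriv]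
    exact hneat (circlePoint θ)
  obtain ⟨u, v, -, hv, hu, h1v, huv⟩ :=
    generalized_tube_lemma isCompact_Icc isCompact_singleton hW hsub
  have h1 : (1 : ℝ) ∈ v := h1v rfl
  obtain ⟨l₀, hl₀, hball⟩ := Metric.isOpen_iff.1 hv 1 h1
  refine ⟨l₀, hl₀, fun x s hs ↦ ?_⟩
  obtain ⟨θ, hθ, rfl⟩ := exists_circlePoint_eq_mem_Icc x
  have hsv : s ∈ v := hball (by rwa [Metric.mem_ball, Real.dist_eq])
  have hmem := huv (mk_mem_prod (hu hθ) hsv)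
  simpa only [mem_setOf_eq] using hmem

/-- **Uniform continuity across the seam.** `‖f (x, s)‖` is uniformly close to `1` for `s` close
to `1` (compactness of `𝕊 1`, tube lemma). [folklore] -/
theorem exists_norm_sub_one_lt (hfc : Continuous f) (h1 : ∀ x : 𝕊 1, ‖f (x, 1)‖ = 1) {ε : ℝ}
    (hε : 0 < ε) :
    ∃ l₁ : ℝ, 0 < l₁ ∧ ∀ x : 𝕊 1, ∀ s : ℝ, |s - 1| < l₁ → |‖f (x, s)‖ - 1| < ε := by
  have hW : IsOpen {p : (𝕊 1) × ℝ | |‖f p‖ - 1| < ε} :=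
    isOpen_lt (continuous_abs.comp ((continuous_norm.comp hfc).sub continuous_const))
      continuous_const
  have hsub : (univ : Set (𝕊 1)) ×ˢ ({1} : Set ℝ) ⊆ {p : (𝕊 1) × ℝ | |‖f p‖ - 1| < ε} := by
    rintro ⟨x, s⟩ ⟨-, hs⟩
    rw [mem_singleton_iff] at hs
    subst hs
    simpa [h1 x] using hε
  obtain ⟨u, v, -, hv, hu, h1v, huv⟩ :=
    generalized_tube_lemma isCompact_univ isCompact_singleton hW hsub
  obtain ⟨l₁, hl₁, hball⟩ := Metric.isOpen_iff.1 hv 1 (h1v rfl)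
  refine ⟨l₁, hl₁, fun x s hs ↦ ?_⟩
  have hsv : s ∈ v := hball (by rwa [Metric.mem_ball, Real.dist_eq])
  exact huv (mk_mem_prod (hu (mem_univ x)) hsv)


/-! ### The scaled clamp and the re-timing function -/

/-- The **scaled clamp** `c(t) = 1 + l κ((t - 1)/l)`: smooth, `c t = t` for `|t - 1| ≤ l`,
`|c t - 1| ≤ 2 l`, `c' ∈ [0, 1]`, `c' = 0` for `|t - 1| ≥ 2 l`. [folklore] -/
def clampAt (l t : ℝ) : ℝ :=
  1 + l * clamp ((t - 1) / l)

/-- `c t = t` on the plateau `|t - 1| ≤ l`. [folklore] -/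
theorem clampAt_of_abs_le {l t : ℝ} (hl : 0 < l) (ht : |t - 1| ≤ l) : clampAt l t = t := by
  unfold clampAt
  rw [clamp_of_abs_le (by rw [abs_div, abs_of_pos hl]; exact (div_le_one hl).2 ht)]
  have hl' : l ≠ 0 := hl.ne'
  field_simp
  ring

/-- `|c t - 1| ≤ 2 l`. [folklore] -/
theorem abs_clampAt_sub_one_le {l : ℝ} (hl : 0 < l) (t : ℝ) : |clampAt l t - 1| ≤ 2 * l := by
  unfold clampAt
  rw [add_sub_cancel_left, abs_mul, abs_of_pos hl]
  nlinarith [abs_clamp_le_two ((t - 1) / l)]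

/-- `c` is `C^∞`. [folklore] -/
theorem contDiff_clampAt (l : ℝ) : ContDiff ℝ ∞ (clampAt l) :=
  contDiff_const.add (contDiff_const.mul (contDiff_clamp.comp
    ((contDiff_id.sub contDiff_const).div_const l)))

/-- `c' t = b((t - 1)/l)`. [folklore] -/
theorem hasDerivAt_clampAt {l : ℝ} (hl : 0 < l) (t : ℝ) :
    HasDerivAt (clampAt l) (plateau ((t - 1) / l)) t := by
  have h1 : HasDerivAt (fun t ↦ (t - 1) / l) (1 / l) t :=
    ((hasDerivAt_id' t).sub_const 1).div_const l
  have h2 := (hasDerivAt_clamp ((t - 1) / l)).comp t h1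
  have h3 := (h2.const_mul l).const_add 1
  have h4 : HasDerivAt (clampAt l) (l * (plateau ((t - 1) / l) * (1 / l))) t := h3
  refine h4.congr_deriv ?_
  rw [one_div, ← mul_assoc, mul_comm l, mul_assoc, mul_inv_cancel₀ hl.ne', mul_one]

/-- `c' = 0` off the strip `|t - 1| < 2 l`. [folklore] -/
theorem plateau_eq_zero_of_le {l t : ℝ} (hl : 0 < l) (ht : 2 * l ≤ |t - 1|) :
    plateau ((t - 1) / l) = 0 := by
  rcases le_or_gt 0 (t - 1) with h | h
  · rw [abs_of_nonneg h] at ht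
    exact plateau_of_ge ((le_div_iff₀ hl).2 (by linarith))
  · rw [abs_of_neg h] at ht
    exact plateau_of_le ((div_le_iff₀ hl).2 (by linarith))

/-- `c` is constant below `1 - 2 l`. [folklore] -/
theorem clampAt_of_le {l t : ℝ} (hl : 0 < l) (ht : t ≤ 1 - 2 * l) :
    clampAt l t = clampAt l (1 - 2 * l) := by
  have h1 : (t - 1) / l ≤ -2 := (div_le_iff₀ hl).2 (by linarith)
  have h2 : (1 - 2 * l - 1) / l ≤ -2 := by rw [div_le_iff₀ hl]; linarith
  unfold clampAt
  rw [clamp_of_le_neg_two h1, clamp_of_le_neg_two h2]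

/-- The outer formula of the re-timing: `Ω (t, ρ) = t + (1 - ψ t) (ρ - c t)`. [folklore] -/
def retimeAux (l : ℝ) (q : ℝ × ℝ) : ℝ :=
  q.1 + (1 - step q.1) * (q.2 - clampAt l q.1)

/-- `Ω` is `C^∞`. [folklore] -/
theorem contDiff_retimeAux (l : ℝ) : ContDiff ℝ ∞ (retimeAux l) :=
  contDiff_fst.add ((contDiff_const.sub (contDiff_step.comp contDiff_fst)).mul
    (contDiff_snd.sub ((contDiff_clampAt l).comp contDiff_fst)))

/-- The **re-timing** `R (x, t) = t + (1 - ψ t) (‖f (x, c t)‖ - c t)`: equal to `‖f (x, t)‖` on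
the plateau `|t - 1| ≤ l`, to `t` for `t ≥ 3/2`. [folklore] -/
def retime (f : (𝕊 1) × ℝ → 𝔼 4) (l : ℝ) (p : (𝕊 1) × ℝ) : ℝ :=
  retimeAux l (p.2, ‖f (p.1, clampAt l p.2)‖)

/-- The `s`-derivative of `‖f (x, ·)‖`. [folklore] -/
def normDeriv (f : (𝕊 1) × ℝ → 𝔼 4) (x : 𝕊 1) (s : ℝ) : ℝ :=
  deriv (fun s ↦ ‖f (x, s)‖) s

/-- The derivative of `t ↦ R (x, t)` (in the form produced by the product rule). [folklore] -/
def retimeDeriv (f : (𝕊 1) × ℝ → 𝔼 4) (l : ℝ) (x : 𝕊 1) (t : ℝ) : ℝ :=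
  1 + (-deriv step t * (‖f (x, clampAt l t)‖ - clampAt l t) +
    (1 - step t) * (normDeriv f x (clampAt l t) * plateau ((t - 1) / l) - plateau ((t - 1) / l)))

/-- **The data of Step 1**: a smooth annulus with `‖f (x, 1)‖ = 1`, a bound `C` on `|ψ'|`, and a
width `l` so small that on the strip `|s - 1| ≤ 2 l` the radial derivative is positive and
`‖f‖` is within `ε₀` of `1`, where `C (ε₀ + 2 l) ≤ 1/2`. [folklore] -/
structure RetimeData (f : (𝕊 1) × ℝ → 𝔼 4) where
  /-- the width of the clamp -/
  l : ℝ
  /-- a bound on `|ψ'|` -/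
  C : ℝ
  /-- the closeness of `‖f‖` to `1` on the strip -/
  ε₀ : ℝ
  smooth : ContMDiff ((𝓡 1).prod 𝓘(ℝ, ℝ)) 𝓘(ℝ, 𝔼 4) ∞ f
  norm_one : ∀ x : 𝕊 1, ‖f (x, 1)‖ = 1
  l_pos : 0 < l
  l_le : l ≤ 1 / 16
  ε₀_le : ε₀ ≤ 1 / 4
  C_nonneg : 0 ≤ C
  bound_step : ∀ t, |deriv step t| ≤ C
  small : C * (ε₀ + 2 * l) ≤ 1 / 2
  pos : ∀ (x : 𝕊 1) (s : ℝ), |s - 1| ≤ 2 * l → 0 < radialDeriv f (x, s)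
  close : ∀ (x : 𝕊 1) (s : ℝ), |s - 1| ≤ 2 * l → |‖f (x, s)‖ - 1| ≤ ε₀

/-- **Existence of the data of Step 1 for a concordance.** [folklore] -/
theorem RetimeData.nonempty {K K' : Knot} (hf : IsConcordance K K' f) :
    Nonempty (RetimeData f) := by
  obtain ⟨hfs, -, -, -, hneat, hK, -⟩ := hf
  have h1 : ∀ x : 𝕊 1, ‖f (x, 1)‖ = 1 := fun x ↦ by rw [hK, norm_eq_of_mem_sphere]
  obtain ⟨C, hC0, hC⟩ := exists_bound_deriv_step
  set ε₀ : ℝ := min (1 / 4) (1 / (4 * C)) with hε₀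
  have hε₀pos : 0 < ε₀ := lt_min (by norm_num) (by positivity)
  obtain ⟨l₀, hl₀, hpos⟩ := exists_radialDeriv_pos hfs fun x ↦ (hneat x).1
  obtain ⟨l₁, hl₁, hclose⟩ := exists_norm_sub_one_lt hfs.continuous h1 hε₀pos
  set l : ℝ := min (1 / 16) (min (l₀ / 4) (min (l₁ / 4) (1 / (16 * C)))) with hl
  have hl16 : l ≤ 1 / 16 := min_le_left _ _
  have hll₀ : l ≤ l₀ / 4 := (min_le_right _ _).trans (min_le_left _ _)
  have hll₁ : l ≤ l₁ / 4 := (min_le_right _ _).trans ((min_le_right _ _).trans (min_le_left _ _))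
  have hlC : l ≤ 1 / (16 * C) :=
    (min_le_right _ _).trans ((min_le_right _ _).trans (min_le_right _ _))
  have hlpos : 0 < l := lt_min (by norm_num) (lt_min (by positivity) (lt_min (by positivity)
    (by positivity)))
  refine ⟨⟨l, C, ε₀, hfs, h1, hlpos, hl16, min_le_left _ _, hC0.le, hC, ?_,
    fun x s hs ↦ hpos x s (by linarith), fun x s hs ↦ (hclose x s (by linarith)).le⟩⟩
  have h1' : C * ε₀ ≤ 1 / 4 := by
    calc C * ε₀ ≤ C * (1 / (4 * C)) := mul_le_mul_of_nonneg_left (min_le_right _ _) hC0.le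
      _ = 1 / 4 := by field_simp
  have h2' : C * (2 * l) ≤ 1 / 8 := by
    calc C * (2 * l) ≤ C * (2 * (1 / (16 * C))) := by gcongr
      _ = 1 / 8 := by field_simp; ring
  linarith [mul_add C ε₀ (2 * l)]

namespace RetimeData

variable (d : RetimeData f)
include d

/-- On the strip, `‖f‖ ≥ 3/4`. [folklore] -/
theorem norm_pos {x : 𝕊 1} {s : ℝ} (hs : |s - 1| ≤ 2 * d.l) : 3 / 4 ≤ ‖f (x, s)‖ := by
  have := d.close x s hs
  rw [abs_le] at this
  linarith [d.ε₀_le]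

/-- On the strip, `f ≠ 0`. [folklore] -/
theorem ne_zero {x : 𝕊 1} {s : ℝ} (hs : |s - 1| ≤ 2 * d.l) : f (x, s) ≠ 0 := by
  intro h
  have := d.norm_pos (x := x) hs
  rw [h, norm_zero] at this
  linarith

/-- The clamp lands in the strip. [folklore] -/
theorem abs_clampAt_le (t : ℝ) : |clampAt d.l t - 1| ≤ 2 * d.l :=
  abs_clampAt_sub_one_le d.l_pos t

/-- The `t`-curves `s ↦ f (x, s)` are `C^∞`. [folklore] -/
theorem contDiff_curve (x : 𝕊 1) : ContDiff ℝ ∞ fun s : ℝ ↦ f (x, s) :=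
  contMDiff_iff_contDiff.1 (d.smooth.comp (contMDiff_const.prodMk contMDiff_id))

/-- `‖f (x, ·)‖` is differentiable on the strip, with derivative `normDeriv`. [folklore] -/
theorem hasDerivAt_norm (x : 𝕊 1) {s : ℝ} (hs : |s - 1| ≤ 2 * d.l) :
    HasDerivAt (fun s ↦ ‖f (x, s)‖) (normDeriv f x s) s :=
  ((((d.contDiff_curve x).differentiable (by simp)) s).norm ℝ (d.ne_zero hs)).hasDerivAt

/-- `∂_s ‖f‖² = 2 ‖f‖ ∂_s ‖f‖` on the strip. [folklore] -/
theorem radialDeriv_eq (x : 𝕊 1) {s : ℝ} (hs : |s - 1| ≤ 2 * d.l) :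
    radialDeriv f (x, s) = 2 * ‖f (x, s)‖ * normDeriv f x s := by
  have h := (d.hasDerivAt_norm x hs).pow 2
  simp only [Nat.cast_ofNat, pow_one, Nat.add_one_sub_one] at h
  exact h.deriv

/-- `∂_s ‖f‖ > 0` on the strip. [folklore] -/
theorem normDeriv_pos (x : 𝕊 1) {s : ℝ} (hs : |s - 1| ≤ 2 * d.l) : 0 < normDeriv f x s := by
  have h1 := d.pos x s hs
  rw [d.radialDeriv_eq x hs] at h1
  have h2 : 0 < 2 * ‖f (x, s)‖ := by linarith [d.norm_pos (x := x) hs]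
  exact pos_of_mul_pos_right h1 h2.le

/-- **`R` is `C^∞` on `𝕊 1 × ℝ`.** [folklore] -/
theorem contMDiff_retime : ContMDiff ((𝓡 1).prod 𝓘(ℝ, ℝ)) 𝓘(ℝ, ℝ) ∞ (retime f d.l) := by
  have hc : ContMDiff ((𝓡 1).prod 𝓘(ℝ, ℝ)) 𝓘(ℝ, ℝ) ∞ fun p : (𝕊 1) × ℝ ↦ clampAt d.l p.2 :=
    (contDiff_clampAt d.l).comp_contMDiff contMDiff_snd
  have hfc : ContMDiff ((𝓡 1).prod 𝓘(ℝ, ℝ)) 𝓘(ℝ, 𝔼 4) ∞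
      fun p : (𝕊 1) × ℝ ↦ f (p.1, clampAt d.l p.2) :=
    d.smooth.comp (contMDiff_fst.prodMk hc)
  have hnorm : ContMDiff ((𝓡 1).prod 𝓘(ℝ, ℝ)) 𝓘(ℝ, ℝ) ∞
      fun p : (𝕊 1) × ℝ ↦ ‖f (p.1, clampAt d.l p.2)‖ := fun p ↦
    ContDiffAt.comp_contMDiffAt (x := p) (f := fun p : (𝕊 1) × ℝ ↦ f (p.1, clampAt d.l p.2))
      (contDiffAt_norm ℝ (d.ne_zero (d.abs_clampAt_le p.2))) (hfc p)
  exact (contDiff_retimeAux d.l).comp_contMDiff (contMDiff_snd.prodMk_space hnorm)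

/-- Pointwise formula for `R`. [folklore] -/
theorem retime_apply (x : 𝕊 1) (t : ℝ) :
    retime f d.l (x, t) = t + (1 - step t) * (‖f (x, clampAt d.l t)‖ - clampAt d.l t) := rfl

/-- **`R (x, 1) = 1`.** [folklore] -/
theorem retime_one (x : 𝕊 1) : retime f d.l (x, 1) = 1 := by
  rw [retime_apply, clampAt_of_abs_le d.l_pos (by simp [d.l_pos.le]), d.norm_one]
  ring

/-- **`R (x, t) = t` for `t ≥ 3/2`.** [folklore] -/
theorem retime_of_ge (x : 𝕊 1) {t : ℝ} (ht : 3 / 2 ≤ t) : retime f d.l (x, t) = t := by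
  rw [retime_apply, step_of_ge ht]
  ring

/-- **`R = ‖f‖` on the plateau** `|t - 1| ≤ l`. [folklore] -/
theorem retime_of_abs_le (x : 𝕊 1) {t : ℝ} (ht : |t - 1| ≤ d.l) :
    retime f d.l (x, t) = ‖f (x, t)‖ := by
  have ht' : t ≤ 5 / 4 := by
    rw [abs_le] at ht
    linarith [d.l_le]
  rw [retime_apply, clampAt_of_abs_le d.l_pos ht, step_of_le ht']
  ring

/-- `R (x, t) = t + const` below `1 - 2 l`. [folklore] -/
theorem retime_of_le (x : 𝕊 1) {t : ℝ} (ht : t ≤ 1 - 2 * d.l) :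
    retime f d.l (x, t) =
      t + (‖f (x, clampAt d.l (1 - 2 * d.l))‖ - clampAt d.l (1 - 2 * d.l)) := by
  have ht' : t ≤ 5 / 4 := by linarith [d.l_pos]
  rw [retime_apply, clampAt_of_le d.l_pos ht, step_of_le ht']
  ring

/-- **The `t`-derivative of `R`.** [folklore] -/
theorem hasDerivAt_retime (x : 𝕊 1) (t : ℝ) :
    HasDerivAt (fun t ↦ retime f d.l (x, t)) (retimeDeriv f d.l x t) t := by
  have hc := hasDerivAt_clampAt d.l_pos t
  have hn := d.hasDerivAt_norm x (d.abs_clampAt_le t)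
  have hcomp : HasDerivAt (fun t ↦ ‖f (x, clampAt d.l t)‖)
      (normDeriv f x (clampAt d.l t) * plateau ((t - 1) / d.l)) t := hn.comp t hc
  have hA : HasDerivAt (fun t ↦ 1 - step t) (-deriv step t) t := (hasDerivAt_step t).const_sub 1
  have h := (hasDerivAt_id t).add (hA.mul (hcomp.sub hc))
  exact h

/-- **`∂_t R > 0` everywhere.** On the strip `|t - 1| < 2 l` (where `ψ = 0`) the derivative is
the convex combination `(1 - c') + c' ∂_s‖f‖ > 0`; off it (`c' = 0`) it is
`1 - ψ' (‖f (x, c t)‖ - c t) ≥ 1 - C (ε₀ + 2 l) ≥ 1/2`. [folklore] -/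
theorem retimeDeriv_pos (x : 𝕊 1) (t : ℝ) : 0 < retimeDeriv f d.l x t := by
  unfold retimeDeriv
  set c' := plateau ((t - 1) / d.l) with hc'
  have hc'0 : 0 ≤ c' := plateau_nonneg _
  have hc'1 : c' ≤ 1 := plateau_le_one _
  rcases lt_or_ge |t - 1| (2 * d.l) with ht | ht
  · -- on the strip: `ψ t = 0`, `ψ' t = 0`
    have ht5 : t < 5 / 4 := by
      rw [abs_lt] at ht
      linarith [d.l_le]
    rw [step_of_le ht5.le, deriv_step_of_lt ht5]
    have hn := d.normDeriv_pos x (d.abs_clampAt_le t)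
    nlinarith [mul_nonneg hc'0 hn.le]
  · -- off the strip: `c' = 0`
    have h0 : c' = 0 := plateau_eq_zero_of_le d.l_pos ht
    rw [h0]
    have h1 : |‖f (x, clampAt d.l t)‖ - clampAt d.l t| ≤ d.ε₀ + 2 * d.l := by
      have ha := d.close x _ (d.abs_clampAt_le t)
      have hb := d.abs_clampAt_le t
      calc |‖f (x, clampAt d.l t)‖ - clampAt d.l t|
          = |(‖f (x, clampAt d.l t)‖ - 1) - (clampAt d.l t - 1)| := by ring_nf
        _ ≤ |‖f (x, clampAt d.l t)‖ - 1| + |clampAt d.l t - 1| := abs_sub _ _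
        _ ≤ d.ε₀ + 2 * d.l := add_le_add ha hb
    have h2 : |deriv step t * (‖f (x, clampAt d.l t)‖ - clampAt d.l t)| ≤ 1 / 2 := by
      rw [abs_mul]
      calc |deriv step t| * |‖f (x, clampAt d.l t)‖ - clampAt d.l t|
          ≤ d.C * (d.ε₀ + 2 * d.l) :=
            mul_le_mul (d.bound_step t) h1 (abs_nonneg _) d.C_nonneg
        _ ≤ 1 / 2 := d.small
    have h3 := le_abs_self (deriv step t * (‖f (x, clampAt d.l t)‖ - clampAt d.l t))
    have h4 : (1 - step t) * (normDeriv f x (clampAt d.l t) * 0 - 0) = 0 := by ring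
    rw [h4]
    linarith

/-- `deriv` form of the positivity. [folklore] -/
theorem deriv_retime_pos (x : 𝕊 1) (t : ℝ) : 0 < deriv (fun t ↦ retime f d.l (x, t)) t := by
  rw [(d.hasDerivAt_retime x t).deriv]
  exact d.retimeDeriv_pos x t

/-- **`R (x, ·)` is strictly increasing.** [folklore] -/
theorem strictMono_retime (x : 𝕊 1) : StrictMono fun t ↦ retime f d.l (x, t) :=
  strictMono_of_deriv_pos (d.deriv_retime_pos x)

/-- `R (x, ·)` is continuous. [folklore] -/
theorem continuous_retime (x : 𝕊 1) : Continuous fun t ↦ retime f d.l (x, t) :=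
  d.contMDiff_retime.continuous.comp (Continuous.prodMk_right x)

/-- **`R (x, ·)` is surjective** (it is `t + const` at `-∞` and `t` at `+∞`). [folklore] -/
theorem surjective_retime (x : 𝕊 1) : Surjective fun t ↦ retime f d.l (x, t) := by
  refine (d.continuous_retime x).surjective ?_ ?_
  · refine Filter.tendsto_atTop_atTop.2 fun b ↦ ⟨max b (3 / 2), fun t ht ↦ ?_⟩
    rw [d.retime_of_ge x ((le_max_right _ _).trans ht)]
    exact (le_max_left _ _).trans ht
  · set k := ‖f (x, clampAt d.l (1 - 2 * d.l))‖ - clampAt d.l (1 - 2 * d.l) with hk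
    refine Filter.tendsto_atBot_atBot.2 fun b ↦ ⟨min (b - k) (1 - 2 * d.l), fun t ht ↦ ?_⟩
    rw [d.retime_of_le x (ht.trans (min_le_right _ _))]
    linarith [ht.trans (min_le_left _ _)]

/-- **`R (x, ·)` is a bijection of `ℝ`.** [folklore] -/
theorem bijective_retime (x : 𝕊 1) : Bijective fun t ↦ retime f d.l (x, t) :=
  ⟨(d.strictMono_retime x).injective, d.surjective_retime x⟩

end RetimeData


/-! ### The fibrewise shear `Φ (x, t) = (x, R (x, t))` is a diffeomorphism of `𝕊 1 × ℝ` -/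

namespace RetimeData

variable (d : RetimeData f)
include d

/-- The **shear** `Φ (x, t) = (x, R (x, t))`. [folklore] -/
def shear (p : (𝕊 1) × ℝ) : (𝕊 1) × ℝ :=
  (p.1, retime f d.l p)

/-- Components of the shear (definitional). [folklore] -/
@[simp]
theorem shear_apply (x : 𝕊 1) (t : ℝ) : d.shear (x, t) = (x, retime f d.l (x, t)) := rfl

/-- The shear is `C^∞`. [folklore] -/
theorem contMDiff_shear : ContMDiff ((𝓡 1).prod 𝓘(ℝ, ℝ)) ((𝓡 1).prod 𝓘(ℝ, ℝ)) ∞ d.shear :=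
  contMDiff_fst.prodMk d.contMDiff_retime

/-- The shear is bijective (each fibre map `R (x, ·)` is). [folklore] -/
theorem bijective_shear : Bijective d.shear := by
  refine ⟨fun p q h ↦ ?_, fun q ↦ ?_⟩
  · obtain ⟨x, t⟩ := p
    obtain ⟨x', t'⟩ := q
    simp only [shear_apply, Prod.mk.injEq] at h
    obtain ⟨rfl, h2⟩ := h
    exact Prod.ext rfl ((d.bijective_retime x).1 h2)
  · obtain ⟨x, ρ⟩ := q
    obtain ⟨t, ht⟩ := (d.bijective_retime x).2 ρ
    exact ⟨(x, t), Prod.ext rfl ht⟩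

/-- **The vertical derivative of `R` is `∂_t R`**: `mfderiv R (x, t) (0, 1) = retimeDeriv x t`
(chain rule along the curve `s ↦ (x, s)`, whose differential is `inr`). [folklore] -/
theorem mfderiv_retime_inr (x : 𝕊 1) (t : ℝ) :
    mfderiv ((𝓡 1).prod 𝓘(ℝ, ℝ)) 𝓘(ℝ, ℝ) (retime f d.l) (x, t)
      ((0 : EuclideanSpace ℝ (Fin 1)), (1 : ℝ)) = retimeDeriv f d.l x t := by
  have hR : MDifferentiableAt ((𝓡 1).prod 𝓘(ℝ, ℝ)) 𝓘(ℝ, ℝ) (retime f d.l) (x, t) :=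
    d.contMDiff_retime.mdifferentiableAt (by simp)
  have hγ' : ContMDiff 𝓘(ℝ, ℝ) ((𝓡 1).prod 𝓘(ℝ, ℝ)) ∞ (fun s : ℝ ↦ ((x, s) : (𝕊 1) × ℝ)) :=
    contMDiff_const.prodMk contMDiff_id
  have hγ : MDifferentiableAt 𝓘(ℝ, ℝ) ((𝓡 1).prod 𝓘(ℝ, ℝ)) (fun s : ℝ ↦ ((x, s) : (𝕊 1) × ℝ)) t :=
    hγ'.mdifferentiableAt (by simp)
  have hcomp := mfderiv_comp t hR hγ
  rw [mfderiv_prod_right] at hcomp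
  have h1 : mfderiv 𝓘(ℝ, ℝ) 𝓘(ℝ, ℝ) (retime f d.l ∘ fun s : ℝ ↦ ((x, s) : (𝕊 1) × ℝ)) t (1 : ℝ) =
      retimeDeriv f d.l x t := by
    rw [mfderiv_eq_fderiv]
    exact (d.hasDerivAt_retime x t).deriv
  rw [← h1, hcomp]
  rfl

/-- **The differential of the shear**, as a continuous linear equivalence: the shear
`(v, τ) ↦ (v, τ ∂_t R + D R (v, 0))` (`ContinuousLinearEquiv.skewProd`). [folklore] -/
def shearDeriv (p : (𝕊 1) × ℝ) :
    (EuclideanSpace ℝ (Fin 1) × ℝ) ≃L[ℝ] (EuclideanSpace ℝ (Fin 1) × ℝ) :=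
  (ContinuousLinearEquiv.refl ℝ (EuclideanSpace ℝ (Fin 1))).skewProd
    (ContinuousLinearEquiv.unitsEquivAut ℝ
      (Units.mk0 (retimeDeriv f d.l p.1 p.2) (d.retimeDeriv_pos p.1 p.2).ne'))
    ((mfderiv ((𝓡 1).prod 𝓘(ℝ, ℝ)) 𝓘(ℝ, ℝ) (retime f d.l) p).comp
      (ContinuousLinearMap.inl ℝ (EuclideanSpace ℝ (Fin 1)) ℝ))

/-- `mfderiv Φ p = shearDeriv p`. [folklore] -/
theorem mfderiv_shear (p : (𝕊 1) × ℝ) :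
    mfderiv ((𝓡 1).prod 𝓘(ℝ, ℝ)) ((𝓡 1).prod 𝓘(ℝ, ℝ)) d.shear p =
      (d.shearDeriv p : (EuclideanSpace ℝ (Fin 1) × ℝ) →L[ℝ] (EuclideanSpace ℝ (Fin 1) × ℝ)) := by
  obtain ⟨x, t⟩ := p
  have hR : MDifferentiableAt ((𝓡 1).prod 𝓘(ℝ, ℝ)) 𝓘(ℝ, ℝ) (retime f d.l) (x, t) :=
    d.contMDiff_retime.mdifferentiableAt (by simp)
  have hfst : MDifferentiableAt ((𝓡 1).prod 𝓘(ℝ, ℝ)) (𝓡 1) (Prod.fst : (𝕊 1) × ℝ → 𝕊 1) (x, t) :=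
    mdifferentiableAt_fst
  have h1 : mfderiv ((𝓡 1).prod 𝓘(ℝ, ℝ)) ((𝓡 1).prod 𝓘(ℝ, ℝ)) d.shear (x, t) =
      (mfderiv ((𝓡 1).prod 𝓘(ℝ, ℝ)) (𝓡 1) (Prod.fst : (𝕊 1) × ℝ → 𝕊 1) (x, t)).prod
        (mfderiv ((𝓡 1).prod 𝓘(ℝ, ℝ)) 𝓘(ℝ, ℝ) (retime f d.l) (x, t)) :=
    mfderiv_prodMk hfst hR
  rw [h1, mfderiv_fst]
  set D : (EuclideanSpace ℝ (Fin 1) × ℝ) →L[ℝ] ℝ :=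
    mfderiv ((𝓡 1).prod 𝓘(ℝ, ℝ)) 𝓘(ℝ, ℝ) (retime f d.l) (x, t) with hD
  have ha : D ((0 : EuclideanSpace ℝ (Fin 1)), (1 : ℝ)) = retimeDeriv f d.l x t :=
    d.mfderiv_retime_inr x t
  refine ContinuousLinearMap.ext fun q ↦ ?_
  obtain ⟨v, τ⟩ := q
  have hsplit : D (v, τ) = D (v, 0) + τ * retimeDeriv f d.l x t := by
    have h2 : ((v, τ) : EuclideanSpace ℝ (Fin 1) × ℝ) =
        (v, 0) + τ • ((0 : EuclideanSpace ℝ (Fin 1)), (1 : ℝ)) := by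
      simp
    rw [h2, map_add, map_smul, ha, smul_eq_mul]
  change ((ContinuousLinearMap.fst ℝ (EuclideanSpace ℝ (Fin 1)) ℝ).prod D) (v, τ) =
    d.shearDeriv (x, t) (v, τ)
  rw [ContinuousLinearMap.prod_apply, shearDeriv, ContinuousLinearEquiv.skewProd_apply]
  simp only [ContinuousLinearEquiv.refl_apply, ContinuousLinearEquiv.unitsEquivAut_apply,
    Units.val_mk0, ContinuousLinearMap.coe_fst']
  rw [← hD, hsplit, add_comm]
  rfl

/-- **The shear as a diffeomorphism of `𝕊 1 × ℝ`** (inverse function theorem on manifolds,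
`Literature.Topology.FourManifolds.diffeomorphOfBijectiveOfMfderiv`). [folklore] -/
def shearDiffeo : ((𝕊 1) × ℝ) ≃ₘ^∞⟮(𝓡 1).prod 𝓘(ℝ, ℝ), (𝓡 1).prod 𝓘(ℝ, ℝ)⟯ ((𝕊 1) × ℝ) :=
  diffeomorphOfBijectiveOfMfderiv d.contMDiff_shear (by exact_mod_cast le_top) d.bijective_shear
    d.shearDeriv d.mfderiv_shear

/-- The shear diffeomorphism is the shear (definitional). [folklore] -/
@[simp]
theorem coe_shearDiffeo : ⇑d.shearDiffeo = d.shear := rfl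

/-- The inverse `Ψ = Φ⁻¹` preserves the first coordinate. [folklore] -/
theorem shearDiffeo_symm_fst (q : (𝕊 1) × ℝ) : (d.shearDiffeo.symm q).1 = q.1 := by
  have h := d.shearDiffeo.apply_symm_apply q
  rw [coe_shearDiffeo] at h
  conv_rhs => rw [← h]
  rfl

/-- `R (Ψ q) = q.2`. [folklore] -/
theorem retime_shearDiffeo_symm (q : (𝕊 1) × ℝ) : retime f d.l (d.shearDiffeo.symm q) = q.2 := by
  have h := d.shearDiffeo.apply_symm_apply q
  rw [coe_shearDiffeo] at h
  conv_rhs => rw [← h]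
  rfl

/-- `Ψ q = (q.1, σ)` with `R (q.1, σ) = q.2`. [folklore] -/
theorem shearDiffeo_symm_eq (q : (𝕊 1) × ℝ) :
    d.shearDiffeo.symm q = (q.1, (d.shearDiffeo.symm q).2) := by
  conv_lhs => rw [← Prod.mk.eta (p := d.shearDiffeo.symm q)]
  rw [d.shearDiffeo_symm_fst]

/-- `R (x, σ) = ρ` for `(x, σ) = Ψ (x, ρ)`. [folklore] -/
theorem retime_symm_snd (x : 𝕊 1) (ρ : ℝ) :
    retime f d.l (x, (d.shearDiffeo.symm (x, ρ)).2) = ρ := by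
  have h := d.retime_shearDiffeo_symm (x, ρ)
  rwa [d.shearDiffeo_symm_eq] at h

/-- `Ψ (x, ρ) = (x, ρ)` when `R (x, ρ) = ρ`. [folklore] -/
theorem shearDiffeo_symm_of_retime_eq {x : 𝕊 1} {ρ : ℝ} (h : retime f d.l (x, ρ) = ρ) :
    d.shearDiffeo.symm (x, ρ) = (x, ρ) := by
  have h1 : d.shearDiffeo (x, ρ) = (x, ρ) := by
    rw [coe_shearDiffeo, shear_apply, h]
  conv_lhs => rw [← h1]
  exact d.shearDiffeo.symm_apply_apply (x, ρ)

/-- `Ψ (x, ρ) = (x, ρ)` for `ρ ≥ 3/2`. [folklore] -/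
theorem shearDiffeo_symm_of_ge (x : 𝕊 1) {ρ : ℝ} (hρ : 3 / 2 ≤ ρ) :
    d.shearDiffeo.symm (x, ρ) = (x, ρ) :=
  d.shearDiffeo_symm_of_retime_eq (d.retime_of_ge x hρ)

/-- `Ψ (x, 1) = (x, 1)`. [folklore] -/
theorem shearDiffeo_symm_one (x : 𝕊 1) : d.shearDiffeo.symm (x, 1) = (x, 1) :=
  d.shearDiffeo_symm_of_retime_eq (d.retime_one x)

/-- Monotonicity of the inverse fibre maps: `R (x, a) ≤ ρ ↔ a ≤ σ`. [folklore] -/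
theorem le_symm_snd_iff (x : 𝕊 1) (ρ a : ℝ) :
    a ≤ (d.shearDiffeo.symm (x, ρ)).2 ↔ retime f d.l (x, a) ≤ ρ := by
  conv_rhs => rw [← d.retime_symm_snd x ρ]
  exact ((d.strictMono_retime x).le_iff_le).symm

/-- Monotonicity of the inverse fibre maps: `ρ ≤ R (x, b) ↔ σ ≤ b`. [folklore] -/
theorem symm_snd_le_iff (x : 𝕊 1) (ρ b : ℝ) :
    (d.shearDiffeo.symm (x, ρ)).2 ≤ b ↔ ρ ≤ retime f d.l (x, b) := by
  conv_rhs => rw [← d.retime_symm_snd x ρ]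
  exact ((d.strictMono_retime x).le_iff_le).symm

/-- Strict monotonicity of the inverse fibre maps: `R (x, a) < ρ ↔ a < σ`. [folklore] -/
theorem lt_symm_snd_iff (x : 𝕊 1) (ρ a : ℝ) :
    a < (d.shearDiffeo.symm (x, ρ)).2 ↔ retime f d.l (x, a) < ρ := by
  conv_rhs => rw [← d.retime_symm_snd x ρ]
  exact ((d.strictMono_retime x).lt_iff_lt).symm

/-- Strict monotonicity of the inverse fibre maps: `ρ < R (x, b) ↔ σ < b`. [folklore] -/
theorem symm_snd_lt_iff (x : 𝕊 1) (ρ b : ℝ) :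
    (d.shearDiffeo.symm (x, ρ)).2 < b ↔ ρ < retime f d.l (x, b) := by
  conv_rhs => rw [← d.retime_symm_snd x ρ]
  exact ((d.strictMono_retime x).lt_iff_lt).symm

/-- **On the level zone the re-timed annulus is level preserving**: if `|σ - 1| ≤ l` then
`‖f (Ψ (x, ρ))‖ = ρ`. [folklore] -/
theorem norm_f_symm_of_abs_le (x : 𝕊 1) (ρ : ℝ)
    (h : |(d.shearDiffeo.symm (x, ρ)).2 - 1| ≤ d.l) : ‖f (d.shearDiffeo.symm (x, ρ))‖ = ρ := by
  rw [d.shearDiffeo_symm_eq]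
  dsimp only
  rw [← d.retime_of_abs_le x h]
  exact d.retime_symm_snd x ρ

end RetimeData

/-! ### Step 1: a level-preserving concordance -/

/-- **Step 1 of the straightening: every concordance can be replaced by a level-preserving one.**
For a concordance `f` from `K` to `K'`, the re-timed annulus `f₁ = f ∘ Φ⁻¹` (with `Φ` the shear
of `RetimeData`) is again a concordance from `K` to `K'`, and `‖f₁ (x, ρ)‖ = ρ` for
`ρ ∈ [1, 1 + η]`, some `η > 0`.  (Kosinski 1993, II (2.8.2): a neat submanifold is vertical in
a suitable collar — here the collar coordinate is the radius.) [cite: Kosinski1993, II (2.8.2)] -/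
theorem exists_isConcordance_norm_eq {K K' : Knot} (hf : IsConcordance K K' f) :
    ∃ f₁ : (𝕊 1) × ℝ → 𝔼 4, IsConcordance K K' f₁ ∧
      ∃ η : ℝ, 0 < η ∧ ∀ x : 𝕊 1, ∀ ρ ∈ Icc (1 : ℝ) (1 + η), ‖f₁ (x, ρ)‖ = ρ := by
  obtain ⟨d⟩ := RetimeData.nonempty hf
  obtain ⟨hfs, hfinj, hfimm, hshell, hneat, hK, hK'⟩ := hf
  set Ψ := d.shearDiffeo.symm with hΨ
  have hΨs : ContMDiff ((𝓡 1).prod 𝓘(ℝ, ℝ)) ((𝓡 1).prod 𝓘(ℝ, ℝ)) ∞ Ψ := Ψ.contMDiff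
  -- `Ψ` maps the annulus into the annulus
  have hmem : ∀ x : 𝕊 1, ∀ ρ ∈ Icc (1 : ℝ) 2, (Ψ (x, ρ)).2 ∈ Icc (1 : ℝ) 2 := by
    intro x ρ hρ
    constructor
    · rw [d.le_symm_snd_iff, d.retime_one]
      exact hρ.1
    · rw [d.symm_snd_le_iff, d.retime_of_ge x (by norm_num)]
      exact hρ.2
  have hmem' : ∀ x : 𝕊 1, ∀ ρ ∈ Ioo (1 : ℝ) 2, (Ψ (x, ρ)).2 ∈ Ioo (1 : ℝ) 2 := by
    intro x ρ hρ
    constructor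
    · rw [d.lt_symm_snd_iff, d.retime_one]
      exact hρ.1
    · rw [d.symm_snd_lt_iff, d.retime_of_ge x (by norm_num)]
      exact hρ.2
  have hann : ∀ q ∈ (univ : Set (𝕊 1)) ×ˢ Icc (1 : ℝ) 2, Ψ q ∈ (univ : Set (𝕊 1)) ×ˢ Icc (1 : ℝ) 2 := by
    rintro ⟨x, ρ⟩ ⟨-, hρ⟩
    refine ⟨mem_univ _, ?_⟩
    exact hmem x ρ hρ
  refine ⟨f ∘ Ψ, ⟨?_, ?_, ?_, ?_, ?_, ?_, ?_⟩, ?_⟩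
  · exact hfs.comp hΨs
  · intro q hq q' hq' h
    exact Ψ.injective (hfinj (hann q hq) (hann q' hq') h)
  · intro q hq
    have hdΨ : MDifferentiableAt ((𝓡 1).prod 𝓘(ℝ, ℝ)) ((𝓡 1).prod 𝓘(ℝ, ℝ)) Ψ q :=
      hΨs.mdifferentiableAt (by simp)
    have hdf : MDifferentiableAt ((𝓡 1).prod 𝓘(ℝ, ℝ)) 𝓘(ℝ, 𝔼 4) f (Ψ q) :=
      hfs.mdifferentiableAt (by simp)
    rw [mfderiv_comp q hdf hdΨ]
    have hinj : Injective (mfderiv ((𝓡 1).prod 𝓘(ℝ, ℝ)) ((𝓡 1).prod 𝓘(ℝ, ℝ)) Ψ q) := by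
      rw [← Ψ.mfderivToContinuousLinearEquiv_coe (by simp)]
      exact (Ψ.mfderivToContinuousLinearEquiv (by simp) q).injective
    exact (hfimm (Ψ q) (hann q hq)).comp hinj
  · intro x ρ hρ
    have h := hmem' x ρ hρ
    rw [comp_apply, d.shearDiffeo_symm_eq]
    exact hshell x _ h
  · intro x
    constructor
    · -- near `ρ = 1` the re-timed annulus is level preserving: `‖f₁ (x, ρ)‖² = ρ²`
      have hev : (fun ρ ↦ ‖(f ∘ Ψ) (x, ρ)‖ ^ 2) =ᶠ[𝓝 1] fun ρ ↦ ρ ^ 2 := by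
        have hlo : retime f d.l (x, 1 - d.l) < retime f d.l (x, 1) :=
          d.strictMono_retime x (by linarith [d.l_pos])
        have hhi : retime f d.l (x, 1) < retime f d.l (x, 1 + d.l) :=
          d.strictMono_retime x (by linarith [d.l_pos])
        rw [d.retime_one] at hlo hhi
        filter_upwards [Ioo_mem_nhds hlo hhi] with ρ hρ
        have h1 : 1 - d.l < (Ψ (x, ρ)).2 := (d.lt_symm_snd_iff x ρ _).2 hρ.1
        have h2 : (Ψ (x, ρ)).2 < 1 + d.l := (d.symm_snd_lt_iff x ρ _).2 hρ.2
        rw [comp_apply, d.norm_f_symm_of_abs_le x ρ (abs_le.2 ⟨by linarith, by linarith⟩)]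
      rw [hev.deriv_eq]
      norm_num
    · -- near `ρ = 2` the re-timed annulus is `f`
      have hev : (fun ρ ↦ ‖(f ∘ Ψ) (x, ρ)‖ ^ 2) =ᶠ[𝓝 2] fun ρ ↦ ‖f (x, ρ)‖ ^ 2 := by
        filter_upwards [Ioi_mem_nhds (by norm_num : (3 / 2 : ℝ) < 2)] with ρ hρ
        rw [comp_apply, d.shearDiffeo_symm_of_ge x (le_of_lt hρ)]
      rw [hev.deriv_eq]
      exact (hneat x).2
  · intro x
    rw [comp_apply, d.shearDiffeo_symm_one, hK]
  · intro x
    rw [comp_apply, d.shearDiffeo_symm_of_ge x (by norm_num), hK']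
  · -- the uniform level zone `[1, 1 + η]`, `η = min_x ‖f (x, 1 + l)‖ - 1`
    have hc : Continuous fun x : 𝕊 1 ↦ ‖f (x, 1 + d.l)‖ :=
      (hfs.continuous.comp (continuous_id.prodMk continuous_const)).norm
    obtain ⟨x₀, -, hx₀⟩ :=
      isCompact_univ.exists_isMinOn ⟨circlePoint 0, mem_univ _⟩ hc.continuousOn
    refine ⟨‖f (x₀, 1 + d.l)‖ - 1, ?_, fun x ρ hρ ↦ ?_⟩
    · have h : retime f d.l (x₀, 1) < retime f d.l (x₀, 1 + d.l) :=
        d.strictMono_retime x₀ (by linarith [d.l_pos])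
      rw [d.retime_one, d.retime_of_abs_le x₀
        (by rw [add_sub_cancel_left, abs_of_pos d.l_pos])] at h
      linarith
    · have hle : ‖f (x₀, 1 + d.l)‖ ≤ ‖f (x, 1 + d.l)‖ := hx₀ (mem_univ x)
      have h1 : 1 ≤ (Ψ (x, ρ)).2 := by
        rw [d.le_symm_snd_iff, d.retime_one]
        exact hρ.1
      have h2 : (Ψ (x, ρ)).2 ≤ 1 + d.l := by
        rw [d.symm_snd_le_iff, d.retime_of_abs_le x
          (by rw [add_sub_cancel_left, abs_of_pos d.l_pos])]
        linarith [hρ.2]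
      exact d.norm_f_symm_of_abs_le x ρ (abs_le.2 ⟨by linarith [d.l_pos], by linarith⟩)


/-! ### Step 2: freezing the angular part near the inner end -/

/-- The **freezing time** `c₂(ρ) = 1 + (ρ - 1) S((ρ - 1 - δ)/δ)`: `= 1` for `ρ ≤ 1 + δ`, `= ρ`
for `ρ ≥ 1 + 2δ`, always `≥ 1`, and `≤ ρ` for `ρ ≥ 1`. [folklore] -/
def freezeTime (δ ρ : ℝ) : ℝ :=
  1 + (ρ - 1) * Real.smoothTransition ((ρ - 1 - δ) / δ)

/-- `c₂` is `C^∞`. [folklore] -/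
theorem contDiff_freezeTime (δ : ℝ) : ContDiff ℝ ∞ (freezeTime δ) :=
  contDiff_const.add ((contDiff_id.sub contDiff_const).mul (Real.smoothTransition.contDiff.comp
    (((contDiff_id.sub contDiff_const).sub contDiff_const).div_const δ)))

/-- `c₂ ρ = 1` for `ρ ≤ 1 + δ`. [folklore] -/
theorem freezeTime_of_le {δ ρ : ℝ} (hδ : 0 < δ) (h : ρ ≤ 1 + δ) : freezeTime δ ρ = 1 := by
  unfold freezeTime
  rw [Real.smoothTransition.zero_of_nonpos (div_nonpos_of_nonpos_of_nonneg (by linarith) hδ.le)]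
  ring

/-- `c₂ ρ = ρ` for `ρ ≥ 1 + 2δ`. [folklore] -/
theorem freezeTime_of_ge {δ ρ : ℝ} (hδ : 0 < δ) (h : 1 + 2 * δ ≤ ρ) : freezeTime δ ρ = ρ := by
  unfold freezeTime
  rw [Real.smoothTransition.one_of_one_le ((one_le_div hδ).2 (by linarith))]
  ring

/-- `1 ≤ c₂ ρ` (for all `ρ`). [folklore] -/
theorem one_le_freezeTime {δ : ℝ} (hδ : 0 < δ) (ρ : ℝ) : 1 ≤ freezeTime δ ρ := by
  rcases le_or_gt ρ 1 with h | h
  · rw [freezeTime_of_le hδ (by linarith)]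
  · unfold freezeTime
    nlinarith [Real.smoothTransition.nonneg ((ρ - 1 - δ) / δ)]

/-- `0 < c₂ ρ`. [folklore] -/
theorem freezeTime_pos {δ : ℝ} (hδ : 0 < δ) (ρ : ℝ) : 0 < freezeTime δ ρ :=
  lt_of_lt_of_le one_pos (one_le_freezeTime hδ ρ)

/-- `c₂ ρ ≤ ρ` for `ρ ≥ 1`. [folklore] -/
theorem freezeTime_le {δ ρ : ℝ} (h : 1 ≤ ρ) : freezeTime δ ρ ≤ ρ := by
  unfold freezeTime
  nlinarith [Real.smoothTransition.le_one ((ρ - 1 - δ) / δ)]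

/-- The **frozen annulus** `f₂ (x, ρ) = (ρ / c₂ ρ) • f₁ (x, c₂ ρ)`. [folklore] -/
def freeze (f₁ : (𝕊 1) × ℝ → 𝔼 4) (δ : ℝ) (p : (𝕊 1) × ℝ) : 𝔼 4 :=
  (p.2 / freezeTime δ p.2) • f₁ (p.1, freezeTime δ p.2)

/-- Pointwise formula for `freeze`. [folklore] -/
theorem freeze_apply (f₁ : (𝕊 1) × ℝ → 𝔼 4) (δ : ℝ) (x : 𝕊 1) (ρ : ℝ) :
    freeze f₁ δ (x, ρ) = (ρ / freezeTime δ ρ) • f₁ (x, freezeTime δ ρ) := rfl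

/-- On `ρ ≤ 1 + δ` the frozen annulus is the cone `ρ • f₁ (x, 1)`. [folklore] -/
theorem freeze_of_le {f₁ : (𝕊 1) × ℝ → 𝔼 4} {δ ρ : ℝ} (hδ : 0 < δ) (h : ρ ≤ 1 + δ) (x : 𝕊 1) :
    freeze f₁ δ (x, ρ) = ρ • f₁ (x, 1) := by
  rw [freeze_apply, freezeTime_of_le hδ h, div_one]

/-- On `ρ ≥ 1 + 2δ` the frozen annulus is `f₁`. [folklore] -/
theorem freeze_of_ge {f₁ : (𝕊 1) × ℝ → 𝔼 4} {δ ρ : ℝ} (hδ : 0 < δ) (h : 1 + 2 * δ ≤ ρ)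
    (x : 𝕊 1) : freeze f₁ δ (x, ρ) = f₁ (x, ρ) := by
  have hρ : ρ ≠ 0 := by linarith
  rw [freeze_apply, freezeTime_of_ge hδ h, div_self hρ, one_smul]

/-- The frozen annulus is `C^∞` if `f₁` is. [folklore] -/
theorem contMDiff_freeze {f₁ : (𝕊 1) × ℝ → 𝔼 4}
    (hf₁ : ContMDiff ((𝓡 1).prod 𝓘(ℝ, ℝ)) 𝓘(ℝ, 𝔼 4) ∞ f₁) {δ : ℝ} (hδ : 0 < δ) :
    ContMDiff ((𝓡 1).prod 𝓘(ℝ, ℝ)) 𝓘(ℝ, 𝔼 4) ∞ (freeze f₁ δ) := by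
  have hc : ContMDiff ((𝓡 1).prod 𝓘(ℝ, ℝ)) 𝓘(ℝ, ℝ) ∞ fun p : (𝕊 1) × ℝ ↦ freezeTime δ p.2 :=
    (contDiff_freezeTime δ).comp_contMDiff contMDiff_snd
  have hm : ContMDiff ((𝓡 1).prod 𝓘(ℝ, ℝ)) 𝓘(ℝ, ℝ) ∞
      fun p : (𝕊 1) × ℝ ↦ p.2 / freezeTime δ p.2 :=
    (contDiff_id.div (contDiff_freezeTime δ) fun ρ ↦ (freezeTime_pos hδ ρ).ne').comp_contMDiff
      contMDiff_snd
  exact hm.smul (hf₁.comp (contMDiff_fst.prodMk hc))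

/-- **Radial component of the differential of a level-preserving map.** If `‖F q‖ = q.2` near
`p` then `⟪F p, DF_p w⟫ = p.2 · w.2` (differentiate `‖F‖² = ρ²`). [folklore] -/
theorem inner_mfderiv_of_norm_eq_snd {F : (𝕊 1) × ℝ → 𝔼 4} {p : (𝕊 1) × ℝ}
    (hF : MDifferentiableAt ((𝓡 1).prod 𝓘(ℝ, ℝ)) 𝓘(ℝ, 𝔼 4) F p)
    (h : ∀ᶠ q in 𝓝 p, ‖F q‖ = q.2) (w : TangentSpace ((𝓡 1).prod 𝓘(ℝ, ℝ)) p) :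
    inner ℝ (F p) (mfderiv ((𝓡 1).prod 𝓘(ℝ, ℝ)) 𝓘(ℝ, 𝔼 4) F p w) = p.2 * w.2 := by
  -- the two functions `‖F‖²` and `ρ²` agree near `p`
  have hev : (fun q ↦ ‖F q‖ ^ 2) =ᶠ[𝓝 p] ((fun t : ℝ ↦ t ^ 2) ∘ (Prod.snd : (𝕊 1) × ℝ → ℝ)) := by
    filter_upwards [h] with q hq
    rw [hq]
    rfl
  -- derivative of `‖F‖²`
  have h1 : HasMFDerivAt ((𝓡 1).prod 𝓘(ℝ, ℝ)) 𝓘(ℝ, ℝ) (fun q ↦ ‖F q‖ ^ 2) p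
      ((2 • innerSL ℝ (F p)).comp (mfderiv ((𝓡 1).prod 𝓘(ℝ, ℝ)) 𝓘(ℝ, 𝔼 4) F p)) :=
    (hasStrictFDerivAt_norm_sq (F p)).hasFDerivAt.hasMFDerivAt.comp p hF.hasMFDerivAt
  -- derivative of `ρ²`
  have hsqs : ContMDiff 𝓘(ℝ, ℝ) 𝓘(ℝ, ℝ) ∞ (fun t : ℝ ↦ t ^ 2) :=
    contMDiff_iff_contDiff.2 (contDiff_id.pow 2)
  have hd1 : MDifferentiableAt 𝓘(ℝ, ℝ) 𝓘(ℝ, ℝ) (fun t : ℝ ↦ t ^ 2) p.2 :=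
    hsqs.mdifferentiableAt (by simp)
  have hd2 : MDifferentiableAt ((𝓡 1).prod 𝓘(ℝ, ℝ)) 𝓘(ℝ, ℝ) (Prod.snd : (𝕊 1) × ℝ → ℝ) p :=
    mdifferentiableAt_snd
  have h2 := mfderiv_comp p hd1 hd2
  rw [mfderiv_snd, mfderiv_eq_fderiv, (hasDerivAt_pow 2 p.2).hasFDerivAt.fderiv] at h2
  have heq := (hev.mfderiv_eq (I := (𝓡 1).prod 𝓘(ℝ, ℝ)) (I' := 𝓘(ℝ, ℝ))).symm
  rw [h2, h1.mfderiv] at heq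
  have h0v : (ContinuousLinearMap.toSpanSingleton ℝ (((2 : ℕ) : ℝ) * p.2 ^ (2 - 1))) w.2 =
      (2 • innerSL ℝ (F p)) ((mfderiv ((𝓡 1).prod 𝓘(ℝ, ℝ)) 𝓘(ℝ, 𝔼 4) F p w :
        TangentSpace 𝓘(ℝ, 𝔼 4) (F p)) : 𝔼 4) := DFunLike.congr_fun heq w
  rw [ContinuousLinearMap.toSpanSingleton_apply, _root_.smul_apply, innerSL_apply_apply] at h0v
  simp only [nsmul_eq_mul, Nat.cast_ofNat, smul_eq_mul] at h0v
  norm_num at h0v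
  linarith

/-- **Step 2 of the straightening: a level-preserving concordance can be frozen to the cone near
the inner end**, yielding fact B: every concordance from `K` to `K'` can be replaced by one with
`f (x, t) = t • K x` for `t ∈ [1, 1 + δ]`. (Kosinski 1993, II (2.8.2).) [cite: Kosinski1993, II (2.8.2)] -/
theorem exists_isConcordance_radial {K K' : Knot} (hf : IsConcordance K K' f) :
    ∃ f₂ : (𝕊 1) × ℝ → 𝔼 4, IsConcordance K K' f₂ ∧ ∃ δ : ℝ, 0 < δ ∧
      ∀ x : 𝕊 1, ∀ t ∈ Icc (1 : ℝ) (1 + δ), f₂ (x, t) = t • ((K x : 𝕊 3) : 𝔼 4) := by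
  obtain ⟨f₁, hf₁, η₀, hη₀, hlev₀⟩ := exists_isConcordance_norm_eq hf
  obtain ⟨hfs, hfinj, hfimm, hshell, hneat, hK, hK'⟩ := hf₁
  -- shrink the level zone to `[1, 1 + η]` with `η ≤ 1/2`
  set η : ℝ := min η₀ (1 / 2) with hη_def
  have hη : 0 < η := lt_min hη₀ (by norm_num)
  have hη2 : η ≤ 1 / 2 := min_le_right _ _
  have hlev : ∀ x : 𝕊 1, ∀ ρ ∈ Icc (1 : ℝ) (1 + η), ‖f₁ (x, ρ)‖ = ρ := fun x ρ hρ ↦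
    hlev₀ x ρ ⟨hρ.1, hρ.2.trans (by linarith [min_le_left η₀ (1 / 2)])⟩
  -- the far part of the annulus stays outside the radius `m > 1`
  have hcpt : IsCompact ((univ : Set (𝕊 1)) ×ˢ Icc (1 + η) 2) := isCompact_univ.prod isCompact_Icc
  have hne : ((univ : Set (𝕊 1)) ×ˢ Icc (1 + η) 2).Nonempty :=
    ⟨(circlePoint 0, 2), mem_univ _, by constructor <;> linarith⟩
  obtain ⟨q₀, hq₀, hmin⟩ := hcpt.exists_isMinOn hne (hfs.continuous.norm.continuousOn)
  set m : ℝ := ‖f₁ q₀‖ with hm_def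
  have hm1 : 1 < m := by
    obtain ⟨x₀, ρ₀⟩ := q₀
    simp only [mem_prod, mem_univ, true_and, mem_Icc] at hq₀
    rcases eq_or_lt_of_le hq₀.2 with h2 | h2
    · subst h2
      rw [hm_def, hK', norm_smul, norm_eq_of_mem_sphere]
      norm_num
    · exact (hshell x₀ ρ₀ ⟨by linarith [hq₀.1], h2⟩).1
  have hfar : ∀ x : 𝕊 1, ∀ ρ ∈ Icc (1 + η) 2, m ≤ ‖f₁ (x, ρ)‖ := fun x ρ hρ ↦
    hmin ⟨mem_univ _, hρ⟩
  -- the width of the frozen zone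
  set δ : ℝ := min (η / 8) ((m - 1) / 8) with hδ_def
  have hδ : 0 < δ := lt_min (by linarith) (by linarith)
  have hδη : 8 * δ ≤ η := by linarith [min_le_left (η / 8) ((m - 1) / 8)]
  have hδm : 8 * δ ≤ m - 1 := by linarith [min_le_right (η / 8) ((m - 1) / 8)]
  -- norms of the frozen annulus
  have hc_mem : ∀ ρ ∈ Icc (1 : ℝ) (1 + η), freezeTime δ ρ ∈ Icc (1 : ℝ) (1 + η) := fun ρ hρ ↦
    ⟨one_le_freezeTime hδ ρ, (freezeTime_le hρ.1).trans hρ.2⟩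
  have hnorm1 : ∀ x : 𝕊 1, ∀ ρ ∈ Icc (1 : ℝ) (1 + η), ‖freeze f₁ δ (x, ρ)‖ = ρ := by
    intro x ρ hρ
    have hc := hc_mem ρ hρ
    rw [freeze_apply, norm_smul, hlev x _ hc,
      Real.norm_of_nonneg (div_nonneg (by linarith [hρ.1]) (freezeTime_pos hδ ρ).le),
      div_mul_cancel₀ _ (freezeTime_pos hδ ρ).ne']
  have hnorm0 : ∀ x : 𝕊 1, ∀ ρ ∈ Ioc (0 : ℝ) 1, ‖freeze f₁ δ (x, ρ)‖ = ρ := by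
    intro x ρ hρ
    rw [freeze_of_le hδ (by linarith [hρ.2]), norm_smul, hK, norm_eq_of_mem_sphere, mul_one,
      Real.norm_of_nonneg hρ.1.le]
  have hnorm : ∀ x : 𝕊 1, ∀ ρ ∈ Ioo (0 : ℝ) (1 + η), ‖freeze f₁ δ (x, ρ)‖ = ρ := by
    intro x ρ hρ
    rcases le_or_gt ρ 1 with h | h
    · exact hnorm0 x ρ ⟨hρ.1, h⟩
    · exact hnorm1 x ρ ⟨h.le, hρ.2.le⟩
  have hfz_ge : ∀ x : 𝕊 1, ∀ ρ : ℝ, 1 + 2 * δ ≤ ρ → freeze f₁ δ (x, ρ) = f₁ (x, ρ) := fun x ρ hρ ↦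
    freeze_of_ge hδ hρ x
  have hcone : ∀ x : 𝕊 1, ∀ ρ : ℝ, ρ ≤ 1 + δ → freeze f₁ δ (x, ρ) = ρ • ((K x : 𝕊 3) : 𝔼 4) :=
    fun x ρ hρ ↦ by rw [freeze_of_le hδ hρ, hK]
  -- smoothness and differentiability
  have hFs : ContMDiff ((𝓡 1).prod 𝓘(ℝ, ℝ)) 𝓘(ℝ, 𝔼 4) ∞ (freeze f₁ δ) := contMDiff_freeze hfs hδ
  have hdF : ∀ p, MDifferentiableAt ((𝓡 1).prod 𝓘(ℝ, ℝ)) 𝓘(ℝ, 𝔼 4) (freeze f₁ δ) p := fun p ↦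
    hFs.mdifferentiableAt (by simp)
  have hdf : ∀ p, MDifferentiableAt ((𝓡 1).prod 𝓘(ℝ, ℝ)) 𝓘(ℝ, 𝔼 4) f₁ p := fun p ↦
    hfs.mdifferentiableAt (by simp)
  -- `freeze = f₁` near every point with `ρ > 1 + 2δ`
  have hev_far : ∀ x : 𝕊 1, ∀ ρ : ℝ, 1 + 2 * δ < ρ → freeze f₁ δ =ᶠ[𝓝 (x, ρ)] f₁ := by
    intro x ρ hρ
    have hO : IsOpen {q : (𝕊 1) × ℝ | 1 + 2 * δ < q.2} := isOpen_lt continuous_const continuous_snd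
    filter_upwards [hO.mem_nhds hρ] with q hq
    obtain ⟨y, σ⟩ := q
    exact hfz_ge y σ (le_of_lt hq)
  -- `‖freeze‖ = ρ` near every point with `0 < ρ < 1 + η`
  have hev_norm : ∀ x : 𝕊 1, ∀ ρ : ℝ, 0 < ρ → ρ < 1 + η →
      ∀ᶠ q in 𝓝 (x, ρ), ‖freeze f₁ δ q‖ = q.2 := by
    intro x ρ h0 h1
    have hO : IsOpen {q : (𝕊 1) × ℝ | 0 < q.2 ∧ q.2 < 1 + η} :=
      (isOpen_lt continuous_const continuous_snd).inter (isOpen_lt continuous_snd continuous_const)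
    filter_upwards [hO.mem_nhds ⟨h0, h1⟩] with q hq
    obtain ⟨y, σ⟩ := q
    exact hnorm y σ hq
  refine ⟨freeze f₁ δ, ⟨hFs, ?_, ?_, ?_, ?_, ?_, ?_⟩, δ, hδ, fun x t ht ↦ hcone x t ht.2⟩
  · -- injectivity on the annulus
    rintro ⟨x, ρ⟩ ⟨-, hρ⟩ ⟨x', ρ'⟩ ⟨-, hρ'⟩ h
    have key : ∀ {x x' : 𝕊 1} {ρ ρ' : ℝ}, ρ ∈ Icc (1 : ℝ) 2 → ρ' ∈ Icc (1 : ℝ) 2 →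
        ρ ≤ 1 + 2 * δ → 1 + 2 * δ < ρ' → freeze f₁ δ (x, ρ) ≠ freeze f₁ δ (x', ρ') := by
      intro x x' ρ ρ' hρ hρ' h1 h2 heq
      have hn := congrArg norm heq
      rw [hnorm1 x ρ ⟨hρ.1, by linarith⟩, hfz_ge x' ρ' h2.le] at hn
      rcases le_or_gt ρ' (1 + η) with h3 | h3
      · rw [hlev x' ρ' ⟨hρ'.1, h3⟩] at hn
        linarith
      · have := hfar x' ρ' ⟨h3.le, hρ'.2⟩
        linarith
    rcases le_or_gt ρ (1 + 2 * δ) with h1 | h1 <;> rcases le_or_gt ρ' (1 + 2 * δ) with h2 | h2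
    · -- both frozen: equal norms, then cancel the scalar
      have hn : ρ = ρ' := by
        have := congrArg norm h
        rwa [hnorm1 x ρ ⟨hρ.1, by linarith⟩, hnorm1 x' ρ' ⟨hρ'.1, by linarith⟩] at this
      subst hn
      rw [freeze_apply, freeze_apply] at h
      have hs : ρ / freezeTime δ ρ ≠ 0 :=
        div_ne_zero (by linarith [hρ.1]) (freezeTime_pos hδ ρ).ne'
      have h' := smul_right_injective (𝔼 4) hs h
      have hc : freezeTime δ ρ ∈ Icc (1 : ℝ) 2 :=
        ⟨one_le_freezeTime hδ ρ, (freezeTime_le hρ.1).trans hρ.2⟩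
      have := hfinj ⟨mem_univ x, hc⟩ ⟨mem_univ x', hc⟩ h'
      simp only [Prod.mk.injEq] at this
      rw [this.1]
    · exact absurd h (key hρ hρ' h1 h2)
    · exact absurd h.symm (key hρ' hρ h2 h1)
    · rw [hfz_ge x ρ h1.le, hfz_ge x' ρ' h2.le] at h
      exact hfinj ⟨mem_univ _, hρ⟩ ⟨mem_univ _, hρ'⟩ h
  · -- immersion on the annulus
    rintro ⟨x, ρ⟩ ⟨-, hρ⟩
    rcases lt_or_ge (1 + 2 * δ) ρ with h1 | h1
    · rw [(hev_far x ρ h1).mfderiv_eq]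
      exact hfimm (x, ρ) ⟨mem_univ _, hρ⟩
    · -- in the frozen zone `ρ ≤ 1 + 2δ < 1 + η`
      have hρη : ρ < 1 + η := by linarith
      have hρ0 : (0 : ℝ) < ρ := by
        have : (1 : ℝ) ≤ ρ := hρ.1
        linarith
      -- radial component: `⟪f₂, D w⟫ = ρ w.2`
      have hrad : ∀ w : TangentSpace ((𝓡 1).prod 𝓘(ℝ, ℝ)) ((x, ρ) : (𝕊 1) × ℝ),
          inner ℝ (freeze f₁ δ (x, ρ))
            (mfderiv ((𝓡 1).prod 𝓘(ℝ, ℝ)) 𝓘(ℝ, 𝔼 4) (freeze f₁ δ) (x, ρ) w) = ρ * w.2 :=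
        inner_mfderiv_of_norm_eq_snd (hdF _) (hev_norm x ρ hρ0 hρη)
      -- horizontal component: `D (v, 0) = (ρ / c₂ ρ) • Df₁ (v, 0)` at `(x, c₂ ρ)`
      set σ := freezeTime δ ρ with hσ
      have hσmem : σ ∈ Icc (1 : ℝ) 2 :=
        ⟨one_le_freezeTime hδ ρ, (freezeTime_le hρ.1).trans hρ.2⟩
      have hι : ∀ s : ℝ, MDifferentiableAt (𝓡 1) ((𝓡 1).prod 𝓘(ℝ, ℝ))
          (fun y : 𝕊 1 ↦ ((y, s) : (𝕊 1) × ℝ)) x := fun s ↦ by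
        have h : ContMDiff (𝓡 1) ((𝓡 1).prod 𝓘(ℝ, ℝ)) ∞ (fun y : 𝕊 1 ↦ ((y, s) : (𝕊 1) × ℝ)) :=
          contMDiff_id.prodMk contMDiff_const
        exact h.mdifferentiableAt (by simp)
      -- the horizontal derivative: `Df₂ ∘ inl = (ρ/σ) • Df₁ ∘ inl` (restrict to the circle)
      have hfun : (freeze f₁ δ ∘ fun y : 𝕊 1 ↦ ((y, ρ) : (𝕊 1) × ℝ)) =
          (ρ / σ) • (f₁ ∘ fun y : 𝕊 1 ↦ ((y, σ) : (𝕊 1) × ℝ)) := by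
        funext y
        rfl
      have hl := mfderiv_comp x (hdF (x, ρ)) (hι ρ)
      have hr := mfderiv_comp x (hdf (x, σ)) (hι σ)
      rw [hfun, const_smul_mfderiv ((hdf (x, σ)).comp x (hι σ)), hr, mfderiv_prod_left] at hl
      rw [mfderiv_prod_left] at hl
      -- `hl : (ρ/σ) • (Df₁ ∘ inl) = Df₂ ∘ inl`
      refine (injective_iff_map_eq_zero _).2 fun w hw ↦ ?_
      -- the vertical component of `w` vanishes
      have hw2 : w.2 = 0 := by
        have h := hrad w
        rw [hw] at h
        have h' : inner ℝ (freeze f₁ δ (x, ρ)) (0 : 𝔼 4) = ρ * w.2 := h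
        rw [inner_zero_right] at h'
        exact (mul_eq_zero.1 h'.symm).resolve_left hρ0.ne'
      have hw' : w = ((w.1, 0) : TangentSpace ((𝓡 1).prod 𝓘(ℝ, ℝ)) ((x, ρ) : (𝕊 1) × ℝ)) :=
        Prod.ext rfl hw2
      -- evaluate `hl` at `w.1`
      have e1 : ((mfderiv ((𝓡 1).prod 𝓘(ℝ, ℝ)) 𝓘(ℝ, 𝔼 4) (freeze f₁ δ) (x, ρ)).comp
          (ContinuousLinearMap.inl ℝ (TangentSpace (𝓡 1) x) (TangentSpace 𝓘(ℝ, ℝ) ρ))) w.1 =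
          0 := by
        rw [← hw] 
        conv_rhs => rw [hw']
        rfl
      rw [← hl] at e1
      have e2 : (ρ / σ) • (mfderiv ((𝓡 1).prod 𝓘(ℝ, ℝ)) 𝓘(ℝ, 𝔼 4) f₁ (x, σ))
          ((ContinuousLinearMap.inl ℝ (TangentSpace (𝓡 1) x) (TangentSpace 𝓘(ℝ, ℝ) σ)) w.1) =
          0 := e1
      have hs : ρ / σ ≠ 0 := div_ne_zero hρ0.ne' (freezeTime_pos hδ ρ).ne'
      have e3 := (smul_eq_zero_iff_right hs).1 e2
      have e4 := (injective_iff_map_eq_zero _).1 (hfimm (x, σ) ⟨mem_univ _, hσmem⟩) _ e3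
      have e5 : w.1 = 0 := congrArg Prod.fst e4
      rw [hw', e5]
      rfl
  · -- the open annulus goes into the open shell
    intro x ρ hρ
    rcases le_or_gt ρ (1 + 2 * δ) with h1 | h1
    · rw [hnorm1 x ρ ⟨hρ.1.le, by linarith⟩]
      exact hρ
    · rw [hfz_ge x ρ h1.le]
      exact hshell x ρ hρ
  · -- neatness at both ends
    intro x
    constructor
    · have hev : (fun t ↦ ‖freeze f₁ δ (x, t)‖ ^ 2) =ᶠ[𝓝 1] fun t ↦ t ^ 2 := by
        filter_upwards [Ioo_mem_nhds (by norm_num : (0 : ℝ) < 1) (by linarith : (1 : ℝ) < 1 + η)]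
          with t ht
        rw [hnorm x t ht]
      rw [hev.deriv_eq]
      norm_num
    · have hev : (fun t ↦ ‖freeze f₁ δ (x, t)‖ ^ 2) =ᶠ[𝓝 2] fun t ↦ ‖f₁ (x, t)‖ ^ 2 := by
        filter_upwards [Ioi_mem_nhds (by linarith : (1 : ℝ) + 2 * δ < 2)] with t ht
        rw [hfz_ge x t (le_of_lt ht)]
      rw [hev.deriv_eq]
      exact (hneat x).2
  · intro x
    rw [hcone x 1 (by linarith), one_smul]
  · intro x
    rw [hfz_ge x 2 (by linarith), hK']

end Straightening

end Knot

end Literature.Topology.FourManifolds
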